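import Literature.MathematicalPhysics.QuantumFieldTheory.Balaban1983to89.Node00.Record12BgRowAnalysis
import Literature.MathematicalPhysics.QuantumFieldTheory.Balaban1983to89.T4AxialGaugeSmallField

/-!
# NODE 00 — ROW P11 of the Record13 gate, RANGED (`BgProvisoΛ`), THE GAUGE HALF reduced to its derivative members: clauses (1.12)(a)(b) [I] and (2.38)(a)(b) [III]
# — «U^u = exp iξA, |A| < O(1)LMB·α₀ on □», «U^u = exp iξA, Lⁿξ|A| < BCM·α_{0,n}» — for def-R's background of record, BY THE AXIAL GAUGE on the cubes of record
# and the logarithmic chart, from the scale class bounds of [15] Thm 1 (per-scale reading); the derivative members «|∇^ξA|» displayed for the SAME potentials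

Cell `pub-ymgap`, seat `pub-ymgap-node00-def-P11` (R218 ∕ OPS-NOTE-16; the POSITIVE supplier of row P11; successor of the seat's FILE 2 `Node00/Record12BgRowAnalysis` and FILE 3
`Node00/Record13BgRow`).  [I] = [Balaban1987RG1]; [III] = [Balaban1988Convergent]; [15] = [Balaban1985Variational].

HONEST FRAMING.  Bookkeeping + the lattice axial gauge (pv26's torus non-abelian Poincaré lemma `T4AxialGaugeSmallField.dist1_gaugeAct_axialGauge_le_of_mem_boxBonds`, cited) +
the logarithmic series (`Literature.Analysis.Complex.logOnePlus`, cited), at def-R's objects of record.  CONDITIONAL on the named fact `VariationalThm1Scaled` (FILE 2; a `Prop`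
hypothesis, never asserted).  The DERIVATIVE members of (1.12)∕(2.38) — «`|∇^ξA| < O(1)LMB·α₀`», «`(Lⁿξ)²|∇^ξ_U A| < BCM·α_{0,n}`» — are NOT obtained from plaquette smallness
(they need control of DIFFERENCES of plaquette variables, [15] Thm 1 (9)–(10) «|∇^ηA|, |Δ^ηA| < B₃M…»); they stay DISPLAYED, now for the EXPLICIT axial potentials of this
file (print's gauges of (9) are axial-type; for the minimiser the derivative bound in the axial gauge is (10)'s content).  The cube geometry «every `O(1)LM`-cube meeting
`X ⊂ Λ_j` lies in `Ω_j`» is DISPLAYED (print: compatible partitions + `dist(∂Λ_j, ∂Ω_j) ≥ 2MR_j`, [III] p. 256; the (2.38) layer cubes lie in `Ω_n` BY r11's DEFINITION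
`cubesMS`).  NOTHING of Bałaban asserted; K0″∕K0‴ NOT closed; counts unmoved (typed 28∕28 · discharged 5∕28); one finite `𝕋⁴` torus family; not continuum ∕ OS ∕
mass gap ∕ Clay.  Three `def`s (`boxLo`, `boxHi` — corners of a cube of record on the cover; `axialPotential` — the potential of record), no `instance`, no `sorry`.

THE MECHANISM (§2–§3).  On a non-wrapping box with `n + 1` sites per direction and `|U(∂p) − 1| < δ` on its plaquettes, pv26's axial gauge `u` (values IN `G = SU(N)`)
gives `|U^u(b) − 1| ≤ (d − 1)·n·δ` on every box bond; for `(d − 1)nδ ≤ 1∕2` the chart `A(b) := (iξ)⁻¹ log(1 + (U^u(b) − 1))` has `exp iξA(b) = U^u(b)` and `‖A(b)‖ ≤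
2(d − 1)nδ∕ξ` (`expI_log_eq`, `axial_clauses_of_plaqSmallOn`).  On the `O(1)LM`-cubes of record (`Sect2.cubesI`: `s = L^{j+1}M` fine sites, `ξ = η_j`) with the scale-`j`
class bound `δ = b_j·η_j²`, `b_j ≤ α₀(g_j)`: `‖A‖ < 2(d − 1)·LM·α₀(g_j)` — print's `O(1)LMB·α₀` with «B sufficiently large» = `2(d − 1)LM < O(1)LMB` (§4–§5); on the layer
cubes of (2.38) (`Sect2.cubesMS`: `s = LⁿM`, chart at `ξ = η_j`, weight `Lⁿξ`): `Lⁿξ‖A‖ ≤ 2(d − 1)·M·b_n < BCM·α_{0,n}` for `2(d − 1)M < BCM` (§4b–§5b).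

CONTENTS.  §1 `boxLo`∕`boxHi`, `cubeEnl_zero_eq` (def-R's cube = pv26's box), `boxHi_le`, `mem_boxBonds_of_src_tgt_mem` (no wrapping: `s < 2L^{m+K}`), `boxPlaqs_subset_plaqsOf`.
§2 `expI_log_eq` (the chart).  §3 `axialPotential`, `gaugeU_ιSU`, ★ `axial_clauses_of_plaqSmallOn`.  §4 ★ `localGauge_cubesI_of_classBound` (r11's `CondI.localGauge` SHAPE on
`cubesI M j Y` from a scale-`j` class bound on `Ω ⊇` the cubes, clause (c) threaded), `side_pred_mul_eta_le`.  §4b `L_pow_mul_eta`, `side_pred_mul_eta_le'`, ★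
`condII238_cubesMS_of_classBounds` (r11's `CondII238` on the multi-scale frame of record).  §5 ★ `hloc_of_thm1Scaled_axial` = FILE 2's displayed (1.12) clause `hloc` from
`h15` + numerics + `hcubeΩ` + `hsN` + the derivative member `h3`; §5b ★ `h238_of_thm1Scaled_axial` = FILE 2's displayed (2.38) clause from `h15` + numerics + `hsN` + `h3`.  §6 ★★
`bgProvisoΛ_UbgMSOfRecord_of_thm1Scaled_axial` — THE RANGED ROW at def-R's objects ⟸ `VariationalThm1Scaled B₃ a₀ a₁` ∧ numerics (FILE 2's + `2(d−1)LM < cB`, `2(d−1)M <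
BCMr`, `(d−1)LMη_jα₀(g_j) ≤ ½`, `(d−1)Mη_nα₀(g_n) ≤ ½`) ∧ geometry (`hcubeΩ`, `hsN`) ∧ the two DERIVATIVE members for the axial potentials (`h3I`, `h3MS`).

WHAT REMAINS OF ROW P11 AFTER THIS FILE (for the gate ∕ the successor, numbers not adjectives): (R1) the named fact `VariationalThm1Scaled` = [15] Thm 1 (8) in the
per-scale reading — XL if proved in the tree; (R2) the derivative members `h3I`∕`h3MS` = [15] Thm 1 (9)–(10) for the axial potentials of the minimiser on the cubes of
record — L (a named fact + the observation that (9)'s gauge is axial-type, or a direct lattice argument from (10)); (R3) the cube geometry `hcubeΩ` — S–M, combinatorics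
of `cubeIndices`∕`dCubeSide` nestedness (`R_j ≥ L`) + a `2MR_j` separation clause that `Chain21` does not carry (located: print's admissible sequences have it, (2.1) ff.
p. 256; r11's `Seq` types only the inclusions); (R4) the numerics — letters of the family (node00-def-K0a `theta13OfNumerics`): FILE 2's four + this file's four, all
inequalities between the record's letters and print's constants `B₃, a₀, a₁`, `d = 4`, `L`, `M`.

DEPENDENCES (by name): FILE 2 (`VariationalThm1Scaled`, `plaqSmallOn_UbgMSOfRecord_of_thm1Scaled`, `bgProvisoΛ_UbgMSOfRecord_of_thm1Scaled`); def-R (`cubeEnl`, `cubeIndices`,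
`Sect2.cubesI`, `Sect2.cubesMS`, `Sect2.frameMS`, `Sect2.regionOfSet`, `UbgMSOfRecord`, `regSuppOfRecord`, `omegaPlaqs_of_ne_zero`, `BgProvisoΛ`, `Sect2.admB`); pv26
`T4AxialGaugeSmallField` (`castSite`, `castSite_add_e`, `boxBonds`, `boxPlaqs`, `axialGauge`, `dist1_gaugeAct_axialGauge_le_of_mem_boxBonds`); r11 `B12RegularSpaces111`
(`gaugeU`, `expI`, `grad`), `B14RegularSpaces234.CondII238`, `B14Radii.rad238`, `B8Eq17ClassAkV1.plaqsOf`; `Literature.Analysis.Complex` (`logOnePlus`, `exp_logOnePlus_sub_one`,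
`norm_logOnePlus_le_two_mul`); `Beta.BackgroundVertices.expUnit`; `ιSU`, `ιSU_mem_G`.
-/

noncomputable section

open MeasureTheory
open scoped Matrix.Norms.L2Operator

namespace Literature.MathematicalPhysics.QuantumFieldTheory.Balaban1983to89.Node00

open T4Continuum B14.Eq218Concrete B15DeterminingSets B12RegularSpaces111 B14RegularSpaces234 B14Radii T4AxialGaugeSmallField
open Literature.Analysis.Complex (logOnePlus norm_logOnePlus_le_two_mul exp_logOnePlus_sub_one)
open B7Prop1Explicit (e e_apply)
open Complex (I)

/-! ## §1  The `O(1)LM`-cubes of record as non-wrapping boxes of the torus -/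

section Boxes

variable {P : Params}

/-- The lower corner of the `s`-cube of index `a` on the cover: `s·a`. [cite: Balaban1987RG1, (1.12) p.262 (bookkeeping)] -/
def boxLo (s : ℕ) (a : Fin P.d → ℤ) : Fin P.d → ℤ := fun κ => (s : ℤ) * a κ

/-- The upper corner of the `s`-cube of index `a` on the cover: `s·a + s − 1`. [cite: Balaban1987RG1, (1.12) p.262 (bookkeeping)] -/
def boxHi (s : ℕ) (a : Fin P.d → ℤ) : Fin P.d → ℤ := fun κ => (s : ℤ) * a κ + ((s : ℤ) - 1)

/-- def-R's `cubeEnl P s a 0` IS the projection of the integer box `[s·a, s·a + s − 1]` (`B15Eq112TorusCover.cover = castSite` at level `0`). [cite: Balaban1988Convergent, (2.17) p.257 (bookkeeping)] -/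
theorem cubeEnl_zero_eq (s : ℕ) (a : Fin P.d → ℤ) :
    cubeEnl P s a 0 = (castSite (j := 0)) '' {x | boxLo s a ≤ x ∧ x ≤ boxHi s a} := by
  unfold cubeEnl B14.Eq213MaximalDomains.cubeExt boxLo boxHi
  ext y
  simp only [Set.mem_image, Set.mem_setOf_eq, Nat.cast_zero, zero_mul, sub_zero, add_zero]
  constructor
  · rintro ⟨z, hz, rfl⟩
    exact ⟨z, ⟨fun κ => (hz κ).1, fun κ => by have := (hz κ).2; linarith⟩, rfl⟩
  · rintro ⟨z, ⟨h1, h2⟩, rfl⟩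
    exact ⟨z, fun κ => ⟨h1 κ, by have := h2 κ; linarith⟩, rfl⟩

/-- The box of an `s`-cube has `s` sites per direction: `hi = lo + (s − 1)`. [cite: Balaban1987RG1, (1.12) p.262 (bookkeeping)] -/
theorem boxHi_le (s : ℕ) (a : Fin P.d → ℤ) (κ : Fin P.d) : boxHi s a κ ≤ boxLo s a κ + ((s - 1 : ℕ) : ℤ) := by
  unfold boxHi boxLo
  rcases Nat.eq_zero_or_pos s with rfl | hs
  · simp
  · rw [Nat.cast_sub hs]; push_cast; linarith

/-- **A bond with BOTH ends in a non-wrapping cube is a box bond** (`s < sitesPerDir`: the step from `hi` does not re-enter the cube through the torus).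
[cite: Balaban1987RG1, (1.12) p.262 (bookkeeping)] -/
theorem mem_boxBonds_of_src_tgt_mem {s : ℕ} (hsN : (s : ℤ) < P.sitesPerDir 0) (a : Fin P.d → ℤ) {b : PBond P 0}
    (hsrc : b.src ∈ cubeEnl P s a 0) (htgt : b.tgt ∈ cubeEnl P s a 0) : b ∈ boxBonds (boxLo s a) (boxHi s a) := by
  rw [cubeEnl_zero_eq] at hsrc htgt
  obtain ⟨x, ⟨hlx, hxh⟩, hx⟩ := hsrc
  obtain ⟨y, ⟨hly, hyh⟩, hy⟩ := htgt
  refine ⟨x, hlx, fun κ => ?_, hx.symm⟩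
  -- `b.tgt = castSite (x + e dir)` and `castSite y = b.tgt`: compare coordinates mod `sitesPerDir 0`
  have htgt' : (castSite (j := 0) (x + e b.dir) : Site P 0) = castSite y := by
    rw [castSite_add_e, hx, hy]; rfl
  have hκ : (((x + e b.dir) κ : ℤ) : ZMod (P.sitesPerDir 0)) = ((y κ : ℤ) : ZMod (P.sitesPerDir 0)) := congr_fun htgt' κ
  rw [ZMod.intCast_eq_intCast_iff_dvd_sub] at hκ
  have h1 := hlx κ; have h2 := hxh κ; have h3 := hly κ; have h4 := hyh κ
  have he : (x + e b.dir) κ = x κ + (if κ = b.dir then 1 else 0) := by simp [e_apply]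
  have hlohi : boxHi s a κ - boxLo s a κ = (s : ℤ) - 1 := by unfold boxHi boxLo; ring
  have h0 : y κ - (x + e b.dir) κ = 0 :=
    Int.eq_zero_of_abs_lt_dvd hκ (abs_sub_lt_iff.2 ⟨by rw [he]; split_ifs <;> linarith, by rw [he]; split_ifs <;> linarith⟩)
  linarith

/-- The plaquettes of a box lie among the plaquettes TOUCHING any site set containing the cube (their base point is in the cube).
[cite: Balaban1985RegularSpaces, p.77 (convention before (1.5); bookkeeping)] -/
theorem boxPlaqs_subset_plaqsOf {s : ℕ} (a : Fin P.d → ℤ) {Ω : Set (Site P 0)} (hΩ : cubeEnl P s a 0 ⊆ Ω) :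
    boxPlaqs (boxLo s a) (boxHi s a) ⊆ B8Eq17ClassAkV1.plaqsOf Ω := by
  rintro p ⟨z, hlz, hzh, hsrc⟩
  refine Or.inl (hΩ ?_)
  rw [cubeEnl_zero_eq, hsrc]
  refine ⟨z, ⟨hlz, fun κ => ?_⟩, rfl⟩
  have h := hzh κ
  have h1 : 0 ≤ e p.μ κ := by rw [e_apply]; split_ifs <;> norm_num
  have h2 : 0 ≤ e p.ν κ := by rw [e_apply]; split_ifs <;> norm_num
  simp only [Pi.add_apply] at h
  linarith

end Boxes

/-! ## §2  The logarithmic chart: a unit near `1` is `exp iξA` with `|A| ≤ 2|u − 1|∕ξ` -/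

section Chart

variable {𝔸 : Type*} [NormedRing 𝔸] [NormedAlgebra ℂ 𝔸] [CompleteSpace 𝔸]

/-- **THE CHART**: for a unit `g` with `‖g − 1‖ ≤ r ≤ 1∕2` and `ξ > 0`, `A := (iξ)⁻¹·log(1 + (g − 1))` has `exp iξA = g` and `‖A‖ ≤ 2r∕ξ` (the logarithmic series of
`Literature.Analysis.Complex.logOnePlus`). [cite: Balaban1987RG1, (1.12)–(1.13) p.262 («U^u = exp iξA»; bookkeeping chart)] -/
theorem expI_log_eq {g : 𝔸ˣ} {r ξ : ℝ} (hg : ‖(g : 𝔸) - 1‖ ≤ r) (hr : r ≤ 1 / 2) (hξ : 0 < ξ) :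
    expI ξ ((I * (ξ : ℂ))⁻¹ • logOnePlus ((g : 𝔸) - 1)) = g ∧ ‖(I * (ξ : ℂ))⁻¹ • logOnePlus ((g : 𝔸) - 1)‖ ≤ 2 * r / ξ := by
  have hIξ : I * (ξ : ℂ) ≠ 0 := mul_ne_zero Complex.I_ne_zero (by exact_mod_cast hξ.ne')
  have hg1 : ‖(g : 𝔸) - 1‖ < 1 := by linarith
  constructor
  · ext
    rw [expI, Beta.BackgroundVertices.val_expUnit, smul_inv_smul₀ hIξ]
    exact exp_logOnePlus_sub_one hg1
  · rw [norm_smul, norm_inv, norm_mul, Complex.norm_I, one_mul, Complex.norm_real, Real.norm_eq_abs, abs_of_pos hξ]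
    have hL := norm_logOnePlus_le_two_mul (hg.trans hr)
    rw [inv_mul_le_iff₀ hξ]
    calc ‖logOnePlus ((g : 𝔸) - 1)‖ ≤ 2 * ‖(g : 𝔸) - 1‖ := hL
      _ ≤ 2 * r := by linarith
      _ = ξ * (2 * r / ξ) := by field_simp

end Chart

/-! ## §3  The axial gauge on a box: clauses (a)(b) of (1.12) for the `SU(N)` background -/

section Axial

variable {N : ℕ} [NeZero N] {P : Params}

/-- **THE AXIAL-GAUGE POTENTIAL OF RECORD on the box `[lo, hi]`**: `A(b) := (iξ)⁻¹·log(U^{u_ax}(b))`, `u_ax` the torus axial gauge of `T4AxialGaugeSmallField` (pv26).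
[cite: Balaban1987RG1, (1.12) p.262; Balaban1985Variational, Thm 1 (9) p.279 («U^u = exp iηA»)] -/
def axialPotential (U : GaugeField P 0 (SU N)) (lo hi : Fin P.d → ℤ) (ξ : ℝ) : PBond P 0 → MatA N := fun b =>
  (I * (ξ : ℂ))⁻¹ • logOnePlus (((ιSU N (GaugeField.gaugeAct (axialGauge U lo hi) U b) : (MatA N)ˣ) : MatA N) - 1)

/-- The embedded gauge action is the gauge action of the embedded field (`ι` is a monoid hom). [cite: Balaban1987RG1, (1.10) p.262 (bookkeeping)] -/
theorem gaugeU_ιSU (u : GaugeTransf P 0 (SU N)) (U : GaugeField P 0 (SU N)) (b : PBond P 0) :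
    gaugeU (fun x => ιSU N (u x)) (fun b' => ιSU N (U b')) b = ιSU N (GaugeField.gaugeAct u U b) := by
  simp only [gaugeU, GaugeField.gaugeAct, map_mul, map_inv]

/-- **CLAUSES (a)(b) OF (1.12) ON A BOX, FROM PLAQUETTE SMALLNESS — the axial gauge + the chart**: if `|U(∂p) − 1| < δ` on the plaquettes of a non-wrapping box with
`n + 1` sites per direction and `(d − 1)·n·δ ≤ 1∕2`, then the `G`-valued axial gauge `u` gives `U^u = exp iξA` on every box bond with `‖A‖ ≤ 2(d − 1)nδ∕ξ`
(pv26's torus non-abelian Poincaré lemma `dist1_gaugeAct_axialGauge_le_of_mem_boxBonds` + §2).  The DERIVATIVE clause `|∇^ξA| < …` of (1.12) is NOT obtained this way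
(it needs control of differences of plaquette variables — [15] Thm 1 (9)–(10)). [cite: Balaban1987RG1, (1.12) p.262; Balaban1985Variational, Thm 1 (9) p.279] -/
theorem axial_clauses_of_plaqSmallOn (U : GaugeField P 0 (SU N)) {lo hi : Fin P.d → ℤ} {δ : ℝ} {n : ℕ} (hU : PlaqSmallOn (boxPlaqs lo hi) δ U)
    (hδ : 0 ≤ δ) (hn : ∀ κ, hi κ ≤ lo κ + n) (hnN : n < P.sitesPerDir 0) (hsmall : ((P.d - 1 : ℕ) : ℝ) * n * δ ≤ 1 / 2) {ξ : ℝ} (hξ : 0 < ξ) :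
    (∀ x, (fun x => ιSU N (axialGauge U lo hi x)) x ∈ (B12RegularSpaces111SpecialUnitary.suModel N).G) ∧
    (∀ b ∈ boxBonds lo hi, gaugeU (fun x => ιSU N (axialGauge U lo hi x)) (fun b' => ιSU N (U b')) b = expI ξ (axialPotential U lo hi ξ b)) ∧
    (∀ b ∈ boxBonds lo hi, ‖axialPotential U lo hi ξ b‖ ≤ 2 * (((P.d - 1 : ℕ) : ℝ) * n * δ) / ξ) := by
  have key : ∀ b ∈ boxBonds lo hi,
      ‖((ιSU N (GaugeField.gaugeAct (axialGauge U lo hi) U b) : (MatA N)ˣ) : MatA N) - 1‖ ≤ ((P.d - 1 : ℕ) : ℝ) * n * δ :=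
    fun b hb => dist1_gaugeAct_axialGauge_le_of_mem_boxBonds U (subset_refl _) hU hδ hn hnN hb
  refine ⟨fun x => ιSU_mem_G N _, fun b hb => ?_, fun b hb => (expI_log_eq (key b hb) hsmall hξ).2⟩
  rw [gaugeU_ιSU]
  exact ((expI_log_eq (key b hb) hsmall hξ).1).symm

end Axial

/-! ## §4  Clauses (a)(b) of (1.12) on the `O(1)LM`-cubes of a domain `X`, from a scale-`j` class bound — clause (c) (the derivative) threaded through -/

section Cubes

variable {N : ℕ} [NeZero N] {P : Params}

/-- **(1.12) ON THE CUBES OF RECORD `cubesI M j Y` FROM A SCALE-`j` CLASS BOUND**, clauses (a)(b) by the axial gauge (§3), clause (c) DISPLAYED for the SAME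
potential (`axialPotential`): if `|U(∂p) − 1| < b·η_j²` on the plaquettes touching `Ω`, every `L^{j+1}M`-cube meeting `Y` lies in `Ω` (print: compatible partitions +
`X ⊂ Λ_j ⊂ Ω_j` with `dist(∂Λ_j, ∂Ω_j) ≥ 2MR_j`, [III] p. 256 — a located geometric side condition), the cubes do not wrap (`L^{j+1}M < 2L^{m+K}`), the chart is
reachable (`(d−1)(s−1)·bη_j² ≤ 1∕2`) and `2(d−1)(s−1)·bη_j < O(1)LMB·α₀`, then every cube `□ ∩ Y` carries a `G`-valued gauge `u` and a potential `A` with `U^u = exp iξA`,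
`|A| < O(1)LMB·α₀` on its bonds — and `|∇^ξ A| < O(1)LMB·α₀` on its derivative pairs IF that holds for the axial potential (hypothesis `h3`, [15] Thm 1 (9)–(10)).
[cite: Balaban1987RG1, (1.12) p.262; Balaban1988Convergent, (2.27)–(2.28) p.259, p.256; Balaban1985Variational, Thm 1 (9)–(10) p.279] -/
theorem localGauge_cubesI_of_classBound {M j : ℕ} {Y Ω : Set (Site P 0)} (hsN : ((B14.Eq213MaximalDomains.side P.L M (j + 1) : ℕ) : ℤ) < P.sitesPerDir 0)
    (hcubeΩ : ∀ a ∈ cubeIndices P (B14.Eq213MaximalDomains.side P.L M (j + 1)),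
      (cubeEnl P (B14.Eq213MaximalDomains.side P.L M (j + 1)) a 0 ∩ Y).Nonempty → cubeEnl P (B14.Eq213MaximalDomains.side P.L M (j + 1)) a 0 ⊆ Ω)
    {U : GaugeField P 0 (SU N)} {b : ℝ} (hb0 : 0 ≤ b) (hU : PlaqSmallOn (B8Eq17ClassAkV1.plaqsOf Ω) (b * P.eta j ^ 2) U)
    (hsmall : ((P.d - 1 : ℕ) : ℝ) * ((B14.Eq213MaximalDomains.side P.L M (j + 1) - 1 : ℕ) : ℝ) * (b * P.eta j ^ 2) ≤ 1 / 2) {cB α₀ : ℝ}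
    (hcB : 2 * (((P.d - 1 : ℕ) : ℝ) * ((B14.Eq213MaximalDomains.side P.L M (j + 1) - 1 : ℕ) : ℝ) * (b * P.eta j ^ 2)) / P.eta j < cB * α₀)
    (h3 : ∀ a ∈ cubeIndices P (B14.Eq213MaximalDomains.side P.L M (j + 1)),
      (cubeEnl P (B14.Eq213MaximalDomains.side P.L M (j + 1)) a 0 ∩ Y).Nonempty →
      ∀ q ∈ (Sect2.regionOfSet P (cubeEnl P (B14.Eq213MaximalDomains.side P.L M (j + 1)) a 0 ∩ Y)).dpairs,
        ‖grad (P.eta j) q.2.1 (fun y => axialPotential U (boxLo (B14.Eq213MaximalDomains.side P.L M (j + 1)) a)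
          (boxHi (B14.Eq213MaximalDomains.side P.L M (j + 1)) a) (P.eta j) ⟨y, q.2.2⟩) q.1‖ < cB * α₀) :
    ∀ C ∈ Sect2.cubesI M j Y, ∃ u : Site P 0 → (MatA N)ˣ, (∀ x, u x ∈ (B12RegularSpaces111SpecialUnitary.suModel N).G) ∧ ∃ A : PBond P 0 → MatA N,
      (∀ bd ∈ C.bonds, gaugeU u (fun b' => ιSU N (U b')) bd = expI (P.eta j) (A bd)) ∧ (∀ bd ∈ C.bonds, ‖A bd‖ < cB * α₀) ∧
      ∀ q ∈ C.dpairs, ‖grad (P.eta j) q.2.1 (fun y => A ⟨y, q.2.2⟩) q.1‖ < cB * α₀ := by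
  rintro C ⟨a, ha, hne, rfl⟩
  set s := B14.Eq213MaximalDomains.side P.L M (j + 1) with hs
  have hξ : 0 < P.eta j := pow_pos (inv_pos.mpr (Nat.cast_pos.mpr P.L_pos)) j
  have hδ : 0 ≤ b * P.eta j ^ 2 := mul_nonneg hb0 (sq_nonneg _)
  have hnN : s - 1 < P.sitesPerDir 0 := by
    have : (s : ℤ) < P.sitesPerDir 0 := hsN
    omega
  have hUbox : PlaqSmallOn (boxPlaqs (boxLo s a) (boxHi s a)) (b * P.eta j ^ 2) U :=
    fun p hp => hU p (boxPlaqs_subset_plaqsOf a (hcubeΩ a ha hne) hp)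
  obtain ⟨hG, hexp, hnorm⟩ := axial_clauses_of_plaqSmallOn U hUbox hδ (boxHi_le s a) hnN hsmall hξ
  refine ⟨_, hG, axialPotential U (boxLo s a) (boxHi s a) (P.eta j), fun bd hbd => hexp bd ?_, fun bd hbd => (hnorm bd ?_).trans_lt hcB, h3 a ha hne⟩
  · exact mem_boxBonds_of_src_tgt_mem hsN a hbd.1.1 hbd.2.1
  · exact mem_boxBonds_of_src_tgt_mem hsN a hbd.1.1 hbd.2.1

/-- The numerics shape: `(s − 1)·η_j ≤ L·M` for the `O(1)LM`-cubes `s = L^{j+1}·M` (so `2(d−1)(s−1)·bη_j ≤ 2(d−1)LM·b`). [cite: Balaban1987RG1, (1.12) p.262 (bookkeeping)] -/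
theorem side_pred_mul_eta_le (M j : ℕ) : ((B14.Eq213MaximalDomains.side P.L M (j + 1) - 1 : ℕ) : ℝ) * P.eta j ≤ (P.L : ℝ) * M := by
  have hL : (0 : ℝ) < P.L := Nat.cast_pos.mpr P.L_pos
  have hη : 0 ≤ P.eta j := (pow_pos (inv_pos.mpr hL) j).le
  have h1 : ((B14.Eq213MaximalDomains.side P.L M (j + 1) - 1 : ℕ) : ℝ) ≤ (P.L : ℝ) ^ (j + 1) * M := by
    have : ((B14.Eq213MaximalDomains.side P.L M (j + 1) - 1 : ℕ) : ℝ) ≤ ((B14.Eq213MaximalDomains.side P.L M (j + 1) : ℕ) : ℝ) := by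
      exact_mod_cast Nat.sub_le _ _
    refine this.trans ?_
    unfold B14.Eq213MaximalDomains.side
    push_cast
    exact le_rfl
  calc ((B14.Eq213MaximalDomains.side P.L M (j + 1) - 1 : ℕ) : ℝ) * P.eta j ≤ (P.L : ℝ) ^ (j + 1) * M * P.eta j :=
        mul_le_mul_of_nonneg_right h1 hη
    _ = (P.L : ℝ) * M := by
        unfold Params.eta
        rw [pow_succ, inv_pow]
        field_simp

end Cubes

/-! ## §4b  Clauses (a)(b) of (2.38) on the layer cubes `cubesMS` (the cubes lie in `Ω_n` BY DEFINITION — no located geometry needed here) -/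

section CubesMS

variable {N : ℕ} [NeZero N] {P : Params}

/-- `Lⁿ·η_n = 1` on `Setup.Params`. [cite: Balaban1987RG1, (1.1) p.260 (bookkeeping)] -/
theorem L_pow_mul_eta (n : ℕ) : (P.L : ℝ) ^ n * P.eta n = 1 := by
  unfold Params.eta
  rw [← mul_pow, mul_inv_cancel₀ (Sect2.L_cast_ne_zero P), one_pow]

/-- The numerics shape for the layer cubes: `(s − 1)·η_n ≤ M` for `s = Lⁿ·M`. [cite: Balaban1988Convergent, (2.38) p.261 (bookkeeping)] -/
theorem side_pred_mul_eta_le' (M n : ℕ) : ((B14.Eq213MaximalDomains.side P.L M n - 1 : ℕ) : ℝ) * P.eta n ≤ (M : ℝ) := by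
  have hL : (0 : ℝ) < P.L := Nat.cast_pos.mpr P.L_pos
  have hη : 0 ≤ P.eta n := (pow_pos (inv_pos.mpr hL) n).le
  have h1 : ((B14.Eq213MaximalDomains.side P.L M n - 1 : ℕ) : ℝ) ≤ (P.L : ℝ) ^ n * M := by
    have : ((B14.Eq213MaximalDomains.side P.L M n - 1 : ℕ) : ℝ) ≤ ((B14.Eq213MaximalDomains.side P.L M n : ℕ) : ℝ) := by
      exact_mod_cast Nat.sub_le _ _
    refine this.trans ?_
    unfold B14.Eq213MaximalDomains.side
    push_cast
    exact le_rfl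
  calc ((B14.Eq213MaximalDomains.side P.L M n - 1 : ℕ) : ℝ) * P.eta n ≤ (P.L : ℝ) ^ n * M * P.eta n := mul_le_mul_of_nonneg_right h1 hη
    _ = (M : ℝ) * ((P.L : ℝ) ^ n * P.eta n) := by ring
    _ = (M : ℝ) := by rw [L_pow_mul_eta, mul_one]

/-- **(2.38) ON THE LAYER CUBES OF RECORD `cubesMS M j Y Ω n` FROM PER-SCALE CLASS BOUNDS**, clauses (a)(b) by the axial gauge on each `LⁿM`-box at the chart scale
`ξ = η_j`, clause (c) (the derivative member) DISPLAYED for the same axial potential: if `|U(∂p) − 1| < b_n·η_n²` on the plaquettes touching `Ω_n` (`1 ≤ n ≤ j`), the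
cubes do not wrap, `(d−1)(s−1)·b_nη_n² ≤ 1∕2` and `Lⁿξ·2(d−1)(s−1)b_nη_n²∕ξ < BCM·α_{0,n}`, then r11's `CondII238` holds for `ι ∘ U` on the multi-scale frame of record.
[cite: Balaban1988Convergent, (2.38) p.261; Balaban1985Variational, Thm 1 (9)–(10) p.279] -/
theorem condII238_cubesMS_of_classBounds {M j : ℕ} {Y : Set (Site P 0)} {Ω : ℕ → Set (Site P 0)}
    (hsN : ∀ n, 1 ≤ n → n ≤ j → ((B14.Eq213MaximalDomains.side P.L M n : ℕ) : ℤ) < P.sitesPerDir 0)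
    {U : GaugeField P 0 (SU N)} {b : ℕ → ℝ} (hb0 : ∀ n, 1 ≤ n → n ≤ j → 0 ≤ b n)
    (hU : ∀ n, 1 ≤ n → n ≤ j → PlaqSmallOn (B8Eq17ClassAkV1.plaqsOf (Ω n)) (b n * P.eta n ^ 2) U)
    (hsmall : ∀ n, 1 ≤ n → n ≤ j → ((P.d - 1 : ℕ) : ℝ) * ((B14.Eq213MaximalDomains.side P.L M n - 1 : ℕ) : ℝ) * (b n * P.eta n ^ 2) ≤ 1 / 2)
    {βc B C Mr : ℝ} {α₀ : ℕ → ℝ}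
    (hrad : ∀ n, 1 ≤ n → n ≤ j →
      (P.L : ℝ) ^ n * P.eta j * (2 * (((P.d - 1 : ℕ) : ℝ) * ((B14.Eq213MaximalDomains.side P.L M n - 1 : ℕ) : ℝ) * (b n * P.eta n ^ 2)) / P.eta j) <
        rad238 B C Mr (α₀ n))
    (h3 : ∀ n, 1 ≤ n → n ≤ j → ∀ a ∈ cubeIndices P (B14.Eq213MaximalDomains.side P.L M n),
      (cubeEnl P (B14.Eq213MaximalDomains.side P.L M n) a 0 ∩ Y).Nonempty → cubeEnl P (B14.Eq213MaximalDomains.side P.L M n) a 0 ⊆ Ω n →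
      ∀ q ∈ (Sect2.regionOfSet P (cubeEnl P (B14.Eq213MaximalDomains.side P.L M n) a 0 ∩ Y)).dpairs,
        ((P.L : ℝ) ^ n * P.eta j) ^ 2 * ‖grad (P.eta j) q.2.1 (fun y => axialPotential U (boxLo (B14.Eq213MaximalDomains.side P.L M n) a)
          (boxHi (B14.Eq213MaximalDomains.side P.L M n) a) (P.eta j) ⟨y, q.2.2⟩) q.1‖ < rad238 B C Mr (α₀ n)) :
    CondII238 (B12RegularSpaces111SpecialUnitary.suModel N) (Sect2.frameMS (Sect2.Residual.unit P (MatA N)) M j Y Ω) (MSConsts.ofParams P βc B C Mr j) α₀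
      (fun b' => ιSU N (U b')) := by
  refine ⟨fun n h1 hn C hC => ?_⟩
  obtain ⟨a, ha, hne, hgeo, rfl⟩ := hC
  set s := B14.Eq213MaximalDomains.side P.L M n with hs
  have hcubeΩ : cubeEnl P s a 0 ⊆ Ω n := by
    rcases hgeo with ⟨_, hsub, _⟩ | ⟨rfl, hsub⟩
    · exact fun x hx => (hsub hx).1
    · exact hsub
  have hξ : 0 < P.eta j := pow_pos (inv_pos.mpr (Nat.cast_pos.mpr P.L_pos)) j
  have hδ : 0 ≤ b n * P.eta n ^ 2 := mul_nonneg (hb0 n h1 hn) (sq_nonneg _)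
  have hnN : s - 1 < P.sitesPerDir 0 := by
    have : (s : ℤ) < P.sitesPerDir 0 := hsN n h1 hn
    omega
  have hUbox : PlaqSmallOn (boxPlaqs (boxLo s a) (boxHi s a)) (b n * P.eta n ^ 2) U :=
    fun p hp => hU n h1 hn p (boxPlaqs_subset_plaqsOf a hcubeΩ hp)
  obtain ⟨hG, hexp, hnorm⟩ := axial_clauses_of_plaqSmallOn U hUbox hδ (boxHi_le s a) hnN (hsmall n h1 hn) hξ
  have hLn : (0 : ℝ) ≤ (P.L : ℝ) ^ n * P.eta j := mul_nonneg (pow_nonneg (Nat.cast_nonneg _) _) hξ.le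
  refine ⟨_, hG, axialPotential U (boxLo s a) (boxHi s a) (P.eta j), fun bd hbd => hexp bd ?_, fun bd hbd => ?_, fun q hq => h3 n h1 hn a ha hne hcubeΩ q hq⟩
  · exact mem_boxBonds_of_src_tgt_mem (hsN n h1 hn) a hbd.1.1 hbd.2.1
  · show (P.L : ℝ) ^ n * P.eta j * ‖axialPotential U (boxLo s a) (boxHi s a) (P.eta j) bd‖ < rad238 B C Mr (α₀ n)
    exact (mul_le_mul_of_nonneg_left (hnorm bd (mem_boxBonds_of_src_tgt_mem (hsN n h1 hn) a hbd.1.1 hbd.2.1)) hLn).trans_lt (hrad n h1 hn)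

end CubesMS

/-! ## §5  At def-R's objects: FILE 2's displayed (1.12) clause from [15] Thm 1 (scaled) + the cube geometry + numerics + the derivative clause in the axial gauge -/

section Record

variable {F : T4Family} {N : ℕ} [NeZero N]

/-- **THE (1.12) CLAUSE `hloc` OF `bgProvisoΛ_UbgMSOfRecord_of_thm1Scaled`, SUPPLIED UP TO ITS DERIVATIVE MEMBER**: for retained solvable `𝐖`, scale `1 ≤ j ≤ k`,
`X ⊆ Λ_j(s)` and every cube `C ∈ cubesI M j (domSites X)`, the axial gauge of def-R's `U_k(s)(𝐖)` on the `L^{j+1}M`-box of `C` gives (a) `U^u = exp iξA` and (b)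
`|A| < O(1)LMB·α₀(g_j)` — from the named fact (class bound `B₃·cR·ε_j·η_j²` on `Ω_j(s)`), the located cube geometry (`hcubeΩ`: cubes meeting `X ⊂ Λ_j` lie in
`Ω_j`; `hsN`: no wrapping), and the numerics `B₃·cR·ε_j ≤ α₀(g_j)`, `2(d−1)LM < O(1)LMB` (print's «B sufficiently large»), `(d−1)·LM·η_j·α₀(g_j) ≤ 1∕2`; (c) the
derivative member is the displayed hypothesis `h3` on the SAME axial potential ([15] Thm 1 (9)–(10)). [cite: Balaban1987RG1, (1.12) p.262; Balaban1988Convergent, (2.28) p.259, p.256; Balaban1985Variational, Thm 1 (8)–(10) p.279] -/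
theorem hloc_of_thm1Scaled_axial {B₃ a₀ a₁ : ℝ} (h15 : VariationalThm1Scaled F N B₃ a₀ a₁) (S : Sect2.Setting (MatA N) (SU N)) (hι : S.ι = ιSU N)
    (h𝓜 : S.𝓜 = B12RegularSpaces111SpecialUnitary.suModel N) (ν : Stage7Numerics) (M : ℕ) (K k : ℕ) (cR : ℝ) (hB₃ : 0 ≤ B₃)
    (hnum : ∀ n, n ≤ k → 0 < cR * epsOfRecord ν S.flow.g n ∧ cR * epsOfRecord ν S.flow.g n ≤ a₁ ∧ B₃ * (cR * epsOfRecord ν S.flow.g n) ≤ ν.εreg)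
    (ha₀ : ν.εreg ≤ a₀)
    (hBα : ∀ j, 1 ≤ j → j ≤ k → B₃ * (cR * epsOfRecord ν S.flow.g j) ≤ S.lf.alpha0 (S.flow.g j))
    (hα : ∀ j, 1 ≤ j → j ≤ k → 0 < S.lf.alpha0 (S.flow.g j))
    (hsN : ∀ j, 1 ≤ j → j ≤ k → ((B14.Eq213MaximalDomains.side (F.P K).L M (j + 1) : ℕ) : ℤ) < (F.P K).sitesPerDir 0)
    (hcB : 2 * (((F.P K).d - 1 : ℕ) : ℝ) * ((F.P K).L * M) < S.cB)
    (hsmallα : ∀ j, 1 ≤ j → j ≤ k → (((F.P K).d - 1 : ℕ) : ℝ) * ((F.P K).L * M) * (F.P K).eta j * S.lf.alpha0 (S.flow.g j) ≤ 1 / 2)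
    (hcubeΩ : ∀ (s : SeqOfRecord F ν M S.flow.g K k) (j : ℕ), 1 ≤ j → j ≤ k → ∀ X : (Sect2.domSys (F.P K) M j).Dom, Sect2.domSites (F.P K) M j X ⊆ s.Λ j →
      ∀ a ∈ cubeIndices (F.P K) (B14.Eq213MaximalDomains.side (F.P K).L M (j + 1)),
        (cubeEnl (F.P K) (B14.Eq213MaximalDomains.side (F.P K).L M (j + 1)) a 0 ∩ Sect2.domSites (F.P K) M j X).Nonempty →
        cubeEnl (F.P K) (B14.Eq213MaximalDomains.side (F.P K).L M (j + 1)) a 0 ⊆ s.Ω j)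
    (h3 : ∀ (s : SeqOfRecord F ν M S.flow.g K k) (W : MSField (F.P K) (SU N)), W ∈ regSuppOfRecord F N ν M S.flow.g K k cR s →
      W ∈ solvableDom (avOfRecord F N K) (regMSOfRecord F N ν K k s.Ω) (genSet s.Ω k) →
      ∀ j, 1 ≤ j → j ≤ k → ∀ X : (Sect2.domSys (F.P K) M j).Dom, Sect2.domSites (F.P K) M j X ⊆ s.Λ j →
      ∀ a ∈ cubeIndices (F.P K) (B14.Eq213MaximalDomains.side (F.P K).L M (j + 1)),
        (cubeEnl (F.P K) (B14.Eq213MaximalDomains.side (F.P K).L M (j + 1)) a 0 ∩ Sect2.domSites (F.P K) M j X).Nonempty →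
        ∀ q ∈ (Sect2.regionOfSet (F.P K) (cubeEnl (F.P K) (B14.Eq213MaximalDomains.side (F.P K).L M (j + 1)) a 0 ∩ Sect2.domSites (F.P K) M j X)).dpairs,
          ‖grad ((F.P K).eta j) q.2.1 (fun y => axialPotential (UbgMSOfRecord F N ν M S.flow.g K k s W)
            (boxLo (B14.Eq213MaximalDomains.side (F.P K).L M (j + 1)) a) (boxHi (B14.Eq213MaximalDomains.side (F.P K).L M (j + 1)) a) ((F.P K).eta j)
            ⟨y, q.2.2⟩) q.1‖ < S.cB * S.lf.alpha0 (S.flow.g j)) :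
    ∀ (s : SeqOfRecord F ν M S.flow.g K k) (W : MSField (F.P K) (SU N)), W ∈ regSuppOfRecord F N ν M S.flow.g K k cR s →
      W ∈ solvableDom (avOfRecord F N K) (regMSOfRecord F N ν K k s.Ω) (genSet s.Ω k) →
      ∀ j, 1 ≤ j → j ≤ k → ∀ X : (Sect2.domSys (F.P K) M j).Dom, Sect2.domSites (F.P K) M j X ⊆ s.Λ j →
      ∀ C ∈ Sect2.cubesI M j (Sect2.domSites (F.P K) M j X), ∃ u : Site (F.P K) 0 → (MatA N)ˣ, (∀ x, u x ∈ S.𝓜.G) ∧ ∃ A : PBond (F.P K) 0 → MatA N,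
        (∀ bd ∈ C.bonds, gaugeU u (fun b' => S.ι (UbgMSOfRecord F N ν M S.flow.g K k s W b')) bd = expI ((F.P K).eta j) (A bd)) ∧
        (∀ bd ∈ C.bonds, ‖A bd‖ < S.cB * S.lf.alpha0 (S.flow.g j)) ∧
        ∀ q ∈ C.dpairs, ‖grad ((F.P K).eta j) q.2.1 (fun y => A ⟨y, q.2.2⟩) q.1‖ < S.cB * S.lf.alpha0 (S.flow.g j) := by
  intro s W hW hsol j h1 hjk X hX C hC
  set b := B₃ * (cR * epsOfRecord ν S.flow.g j) with hb
  have hb0 : 0 ≤ b := mul_nonneg hB₃ (hnum j hjk).1.le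
  have hclass : PlaqSmallOn (B8Eq17ClassAkV1.plaqsOf (s.Ω j)) (b * (F.P K).eta j ^ 2) (UbgMSOfRecord F N ν M S.flow.g K k s W) := by
    have h := plaqSmallOn_UbgMSOfRecord_of_thm1Scaled h15 ν M S.flow.g K k cR s hnum ha₀ hW hsol j hjk
    rwa [omegaPlaqs_of_ne_zero _ (Nat.one_le_iff_ne_zero.mp h1)] at h
  -- the two numerics of §4 from the letter forms
  have hη : 0 < (F.P K).eta j := pow_pos (inv_pos.mpr (Nat.cast_pos.mpr (F.P K).L_pos)) j
  have hside := side_pred_mul_eta_le (P := F.P K) M j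
  have hd : (0 : ℝ) ≤ (((F.P K).d - 1 : ℕ) : ℝ) := Nat.cast_nonneg _
  have hbα : b ≤ S.lf.alpha0 (S.flow.g j) := hBα j h1 hjk
  have hα0 : 0 < S.lf.alpha0 (S.flow.g j) := hα j h1 hjk
  have hprod : (((F.P K).d - 1 : ℕ) : ℝ) * ((B14.Eq213MaximalDomains.side (F.P K).L M (j + 1) - 1 : ℕ) : ℝ) * (b * (F.P K).eta j ^ 2) ≤
      (((F.P K).d - 1 : ℕ) : ℝ) * ((F.P K).L * M) * (F.P K).eta j * S.lf.alpha0 (S.flow.g j) := by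
    have hs0 : (0 : ℝ) ≤ ((B14.Eq213MaximalDomains.side (F.P K).L M (j + 1) - 1 : ℕ) : ℝ) := Nat.cast_nonneg _
    calc (((F.P K).d - 1 : ℕ) : ℝ) * ((B14.Eq213MaximalDomains.side (F.P K).L M (j + 1) - 1 : ℕ) : ℝ) * (b * (F.P K).eta j ^ 2)
        = (((F.P K).d - 1 : ℕ) : ℝ) * ((((B14.Eq213MaximalDomains.side (F.P K).L M (j + 1) - 1 : ℕ) : ℝ)) * (F.P K).eta j) * (F.P K).eta j * b := by ring
      _ ≤ (((F.P K).d - 1 : ℕ) : ℝ) * ((F.P K).L * M) * (F.P K).eta j * S.lf.alpha0 (S.flow.g j) := by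
        gcongr
  have hsmall : (((F.P K).d - 1 : ℕ) : ℝ) * ((B14.Eq213MaximalDomains.side (F.P K).L M (j + 1) - 1 : ℕ) : ℝ) * (b * (F.P K).eta j ^ 2) ≤ 1 / 2 :=
    hprod.trans (hsmallα j h1 hjk)
  have hcB' : 2 * ((((F.P K).d - 1 : ℕ) : ℝ) * ((B14.Eq213MaximalDomains.side (F.P K).L M (j + 1) - 1 : ℕ) : ℝ) * (b * (F.P K).eta j ^ 2)) / (F.P K).eta j <
      S.cB * S.lf.alpha0 (S.flow.g j) := by
    rw [div_lt_iff₀ hη]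
    have hs0 : (0 : ℝ) ≤ ((B14.Eq213MaximalDomains.side (F.P K).L M (j + 1) - 1 : ℕ) : ℝ) := Nat.cast_nonneg _
    calc 2 * ((((F.P K).d - 1 : ℕ) : ℝ) * ((B14.Eq213MaximalDomains.side (F.P K).L M (j + 1) - 1 : ℕ) : ℝ) * (b * (F.P K).eta j ^ 2))
        = (2 * (((F.P K).d - 1 : ℕ) : ℝ) * ((((B14.Eq213MaximalDomains.side (F.P K).L M (j + 1) - 1 : ℕ) : ℝ)) * (F.P K).eta j) * b) * (F.P K).eta j := by ring
      _ ≤ (2 * (((F.P K).d - 1 : ℕ) : ℝ) * ((F.P K).L * M) * S.lf.alpha0 (S.flow.g j)) * (F.P K).eta j := by gcongr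
      _ < S.cB * S.lf.alpha0 (S.flow.g j) * (F.P K).eta j := by
        have := mul_lt_mul_of_pos_right hcB hα0
        nlinarith
  simp only [hι, h𝓜]
  exact localGauge_cubesI_of_classBound (hsN j h1 hjk) (hcubeΩ s j h1 hjk X hX) hb0 hclass hsmall hcB' (h3 s W hW hsol j h1 hjk X hX) C hC

end Record

section RecordMS

variable {F : T4Family} {N : ℕ} [NeZero N]

/-- **THE (2.38) CLAUSE `h238` OF `bgProvisoΛ_UbgMSOfRecord_of_thm1Scaled`, SUPPLIED UP TO ITS DERIVATIVE MEMBER**: for retained solvable `𝐖`, scale `1 ≤ j ≤ k`, any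
domain `X` (the (2.41) range plays no role here), r11's `CondII238` for `ι ∘ U_k(s)(𝐖)` on the multi-scale frame of record — clauses (a)(b) by the axial gauge on each
layer cube (class bounds `B₃·cR·ε_n·η_n²` on `Ω_n(s)` from the named fact; numerics `2(d−1)M < BCM`, `(d−1)·M·η_n·α₀(g_n) ≤ 1∕2`; no wrapping), clause (c) the displayed
hypothesis `h3` for the same axial potentials ([15] Thm 1 (9)–(10)). [cite: Balaban1988Convergent, (2.38) p.261; Balaban1985Variational, Thm 1 (8)–(10) p.279] -/
theorem h238_of_thm1Scaled_axial {B₃ a₀ a₁ : ℝ} (h15 : VariationalThm1Scaled F N B₃ a₀ a₁) (S : Sect2.Setting (MatA N) (SU N)) (hι : S.ι = ιSU N)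
    (h𝓜 : S.𝓜 = B12RegularSpaces111SpecialUnitary.suModel N) (ν : Stage7Numerics) (M : ℕ) (K k : ℕ) (cR : ℝ) (hB₃ : 0 ≤ B₃)
    (hnum : ∀ n, n ≤ k → 0 < cR * epsOfRecord ν S.flow.g n ∧ cR * epsOfRecord ν S.flow.g n ≤ a₁ ∧ B₃ * (cR * epsOfRecord ν S.flow.g n) ≤ ν.εreg)
    (ha₀ : ν.εreg ≤ a₀)
    (hBα : ∀ n, 1 ≤ n → n ≤ k → B₃ * (cR * epsOfRecord ν S.flow.g n) ≤ S.lf.alpha0 (S.flow.g n))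
    (hα : ∀ n, 1 ≤ n → n ≤ k → 0 < S.lf.alpha0 (S.flow.g n))
    (hsN : ∀ n, 1 ≤ n → n ≤ k → ((B14.Eq213MaximalDomains.side (F.P K).L M n : ℕ) : ℤ) < (F.P K).sitesPerDir 0)
    (hBCM : 2 * (((F.P K).d - 1 : ℕ) : ℝ) * M < S.B * S.C * S.Mr)
    (hsmallα : ∀ n, 1 ≤ n → n ≤ k → (((F.P K).d - 1 : ℕ) : ℝ) * M * (F.P K).eta n * S.lf.alpha0 (S.flow.g n) ≤ 1 / 2)
    (h3 : ∀ (s : SeqOfRecord F ν M S.flow.g K k) (W : MSField (F.P K) (SU N)), W ∈ regSuppOfRecord F N ν M S.flow.g K k cR s →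
      W ∈ solvableDom (avOfRecord F N K) (regMSOfRecord F N ν K k s.Ω) (genSet s.Ω k) →
      ∀ j, 1 ≤ j → j ≤ k → ∀ X : (Sect2.domSys (F.P K) M j).Dom, ∀ n, 1 ≤ n → n ≤ j →
      ∀ a ∈ cubeIndices (F.P K) (B14.Eq213MaximalDomains.side (F.P K).L M n),
        (cubeEnl (F.P K) (B14.Eq213MaximalDomains.side (F.P K).L M n) a 0 ∩ Sect2.domSites (F.P K) M j X).Nonempty →
        cubeEnl (F.P K) (B14.Eq213MaximalDomains.side (F.P K).L M n) a 0 ⊆ s.Ω n →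
        ∀ q ∈ (Sect2.regionOfSet (F.P K) (cubeEnl (F.P K) (B14.Eq213MaximalDomains.side (F.P K).L M n) a 0 ∩ Sect2.domSites (F.P K) M j X)).dpairs,
          (((F.P K).L : ℝ) ^ n * (F.P K).eta j) ^ 2 * ‖grad ((F.P K).eta j) q.2.1 (fun y => axialPotential (UbgMSOfRecord F N ν M S.flow.g K k s W)
            (boxLo (B14.Eq213MaximalDomains.side (F.P K).L M n) a) (boxHi (B14.Eq213MaximalDomains.side (F.P K).L M n) a) ((F.P K).eta j) ⟨y, q.2.2⟩) q.1‖ <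
            rad238 S.B S.C S.Mr (S.lf.alpha0 (S.flow.g n))) :
    ∀ (s : SeqOfRecord F ν M S.flow.g K k) (W : MSField (F.P K) (SU N)), W ∈ regSuppOfRecord F N ν M S.flow.g K k cR s →
      W ∈ solvableDom (avOfRecord F N K) (regMSOfRecord F N ν K k s.Ω) (genSet s.Ω k) →
      ∀ j, 1 ≤ j → j ≤ k → ∀ X : (Sect2.domSys (F.P K) M j).Dom,
      Sect2.admB (F.P K) ν M S.flow.g s.Ω s.Λ j (Sect2.domSites (F.P K) M j X) = true →
      CondII238 S.𝓜 (Sect2.frameMS (Sect2.Residual.unit (F.P K) (MatA N)) M j (Sect2.domSites (F.P K) M j X) s.Ω)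
        (MSConsts.ofParams (F.P K) S.βc S.B S.C S.Mr j) (fun n => S.lf.alpha0 (S.flow.g n)) (fun b' => S.ι (UbgMSOfRecord F N ν M S.flow.g K k s W b')) := by
  intro s W hW hsol j h1 hjk X _
  have hclass : ∀ n, 1 ≤ n → n ≤ j →
      PlaqSmallOn (B8Eq17ClassAkV1.plaqsOf (s.Ω n)) (B₃ * (cR * epsOfRecord ν S.flow.g n) * (F.P K).eta n ^ 2) (UbgMSOfRecord F N ν M S.flow.g K k s W) := by
    intro n hn1 hnj
    have h := plaqSmallOn_UbgMSOfRecord_of_thm1Scaled h15 ν M S.flow.g K k cR s hnum ha₀ hW hsol n (hnj.trans hjk)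
    rwa [omegaPlaqs_of_ne_zero _ (Nat.one_le_iff_ne_zero.mp hn1)] at h
  have hηj : 0 < (F.P K).eta j := pow_pos (inv_pos.mpr (Nat.cast_pos.mpr (F.P K).L_pos)) j
  have hd : (0 : ℝ) ≤ (((F.P K).d - 1 : ℕ) : ℝ) := Nat.cast_nonneg _
  have key : ∀ n, 1 ≤ n → n ≤ j →
      (((F.P K).d - 1 : ℕ) : ℝ) * ((B14.Eq213MaximalDomains.side (F.P K).L M n - 1 : ℕ) : ℝ) * (B₃ * (cR * epsOfRecord ν S.flow.g n) * (F.P K).eta n ^ 2) ≤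
        (((F.P K).d - 1 : ℕ) : ℝ) * M * (F.P K).eta n * S.lf.alpha0 (S.flow.g n) := by
    intro n hn1 hnj
    have hside := side_pred_mul_eta_le' (P := F.P K) M n
    have hηn : 0 ≤ (F.P K).eta n := (pow_pos (inv_pos.mpr (Nat.cast_pos.mpr (F.P K).L_pos)) n).le
    have hb0 : 0 ≤ B₃ * (cR * epsOfRecord ν S.flow.g n) := mul_nonneg hB₃ (hnum n (hnj.trans hjk)).1.le
    have hbα := hBα n hn1 (hnj.trans hjk)
    calc (((F.P K).d - 1 : ℕ) : ℝ) * ((B14.Eq213MaximalDomains.side (F.P K).L M n - 1 : ℕ) : ℝ) * (B₃ * (cR * epsOfRecord ν S.flow.g n) * (F.P K).eta n ^ 2)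
        = (((F.P K).d - 1 : ℕ) : ℝ) * (((B14.Eq213MaximalDomains.side (F.P K).L M n - 1 : ℕ) : ℝ) * (F.P K).eta n) * (F.P K).eta n *
            (B₃ * (cR * epsOfRecord ν S.flow.g n)) := by ring
      _ ≤ (((F.P K).d - 1 : ℕ) : ℝ) * M * (F.P K).eta n * S.lf.alpha0 (S.flow.g n) := by gcongr
  simp only [hι, h𝓜]
  refine condII238_cubesMS_of_classBounds (fun n hn1 hnj => hsN n hn1 (hnj.trans hjk))
    (fun n _ hnj => mul_nonneg hB₃ (hnum n (hnj.trans hjk)).1.le) hclass (fun n hn1 hnj => (key n hn1 hnj).trans (hsmallα n hn1 (hnj.trans hjk)))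
    (fun n hn1 hnj => ?_) (fun n hn1 hnj a ha hne hΩ q hq => h3 s W hW hsol j h1 hjk X n hn1 hnj a ha hne hΩ q hq)
  -- the radius inequality: `Lⁿη_j · 2(d−1)(s−1)bη_n²∕η_j = 2(d−1)·[(s−1)η_n]·(Lⁿη_n)·b ≤ 2(d−1)M·α₀(g_n) < BCM·α₀(g_n)`
  have hα0 := hα n hn1 (hnj.trans hjk)
  have hside := side_pred_mul_eta_le' (P := F.P K) M n
  have hb0 : 0 ≤ B₃ * (cR * epsOfRecord ν S.flow.g n) := mul_nonneg hB₃ (hnum n (hnj.trans hjk)).1.le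
  have hbα := hBα n hn1 (hnj.trans hjk)
  have hLη := L_pow_mul_eta (P := F.P K) n
  rw [mul_div_assoc', div_lt_iff₀ hηj]
  unfold rad238
  calc ((F.P K).L : ℝ) ^ n * (F.P K).eta j * (2 * ((((F.P K).d - 1 : ℕ) : ℝ) * ((B14.Eq213MaximalDomains.side (F.P K).L M n - 1 : ℕ) : ℝ) *
        (B₃ * (cR * epsOfRecord ν S.flow.g n) * (F.P K).eta n ^ 2)))
      = (2 * (((F.P K).d - 1 : ℕ) : ℝ) * (((B14.Eq213MaximalDomains.side (F.P K).L M n - 1 : ℕ) : ℝ) * (F.P K).eta n) *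
          (((F.P K).L : ℝ) ^ n * (F.P K).eta n) * (B₃ * (cR * epsOfRecord ν S.flow.g n))) * (F.P K).eta j := by ring
    _ ≤ (2 * (((F.P K).d - 1 : ℕ) : ℝ) * M * 1 * S.lf.alpha0 (S.flow.g n)) * (F.P K).eta j := by rw [hLη]; gcongr
    _ < S.B * S.C * S.Mr * S.lf.alpha0 (S.flow.g n) * (F.P K).eta j := by
        have := mul_lt_mul_of_pos_right hBCM hα0
        nlinarith

end RecordMS

/-! ## §6  ★ THE RANGED ROW with both gauge clauses REDUCED TO THEIR DERIVATIVE MEMBERS in the axial gauge -/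

section Combined

variable {F : T4Family} {N : ℕ} [NeZero N]

/-- **★★ `BgProvisoΛ` AT DEF-R'S OBJECTS from [15] Thm 1 (8) (per-scale reading) + numerics + the located cube geometry + ONLY THE DERIVATIVE MEMBERS of (1.12)∕(2.38)** —
FILE 2's `bgProvisoΛ_UbgMSOfRecord_of_thm1Scaled` with its two gauge clauses supplied by the axial gauge up to «`|∇^ξ A| < …`» for the axial potentials (displayed:
`h3I`, `h3MS` — [15] Thm 1 (9)–(10)).  Numerics added by the gauge half: `2(d−1)LM < O(1)LMB`, `2(d−1)M < BCM` (print's «B sufficiently large»), and the chart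
reachability `(d−1)·LM·η_j·α₀(g_j) ≤ 1∕2`, `(d−1)·M·η_n·α₀(g_n) ≤ 1∕2`; geometry: `hcubeΩ` (cubes of `X ⊂ Λ_j` lie in `Ω_j`), `hsN` (no wrapping).
[cite: Balaban1988Convergent, (2.27)–(2.28) p.259, (2.34)–(2.41) p.261, p.256; Balaban1985Variational, Thm 1 (8)–(10) p.279; Balaban1987RG1, (1.11)–(1.16) p.262] -/
theorem bgProvisoΛ_UbgMSOfRecord_of_thm1Scaled_axial {B₃ a₀ a₁ : ℝ} (h15 : VariationalThm1Scaled F N B₃ a₀ a₁)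
    (S : Sect2.Setting (MatA N) (SU N)) (hι : S.ι = ιSU N) (h𝓜 : S.𝓜 = B12RegularSpaces111SpecialUnitary.suModel N) (hS : S.Laws) (hpos : S.Pos)
    (ν : Stage7Numerics) (M : ℕ) (K k : ℕ) (cR : ℝ) (hB₃ : 0 ≤ B₃)
    (hnum : ∀ n, n ≤ k → 0 < cR * epsOfRecord ν S.flow.g n ∧ cR * epsOfRecord ν S.flow.g n ≤ a₁ ∧ B₃ * (cR * epsOfRecord ν S.flow.g n) ≤ ν.εreg)
    (ha₀ : ν.εreg ≤ a₀)
    (hα : ∀ n, 1 ≤ n → n ≤ k → 0 < S.lf.alpha0 (S.flow.g n) ∧ 0 < S.lf.alpha1 (S.flow.g n))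
    (hBα : ∀ n, 1 ≤ n → n ≤ k → B₃ * (cR * epsOfRecord ν S.flow.g n) ≤ (1 - S.βc) * S.lf.alpha0 (S.flow.g n))
    (hsN : ∀ n, 1 ≤ n → n ≤ k + 1 → ((B14.Eq213MaximalDomains.side (F.P K).L M n : ℕ) : ℤ) < (F.P K).sitesPerDir 0)
    (hcB : 2 * (((F.P K).d - 1 : ℕ) : ℝ) * ((F.P K).L * M) < S.cB) (hBCM : 2 * (((F.P K).d - 1 : ℕ) : ℝ) * M < S.B * S.C * S.Mr)
    (hsmallI : ∀ j, 1 ≤ j → j ≤ k → (((F.P K).d - 1 : ℕ) : ℝ) * ((F.P K).L * M) * (F.P K).eta j * S.lf.alpha0 (S.flow.g j) ≤ 1 / 2)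
    (hsmallMS : ∀ n, 1 ≤ n → n ≤ k → (((F.P K).d - 1 : ℕ) : ℝ) * M * (F.P K).eta n * S.lf.alpha0 (S.flow.g n) ≤ 1 / 2)
    (hcubeΩ : ∀ (s : SeqOfRecord F ν M S.flow.g K k) (j : ℕ), 1 ≤ j → j ≤ k → ∀ X : (Sect2.domSys (F.P K) M j).Dom, Sect2.domSites (F.P K) M j X ⊆ s.Λ j →
      ∀ a ∈ cubeIndices (F.P K) (B14.Eq213MaximalDomains.side (F.P K).L M (j + 1)),
        (cubeEnl (F.P K) (B14.Eq213MaximalDomains.side (F.P K).L M (j + 1)) a 0 ∩ Sect2.domSites (F.P K) M j X).Nonempty →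
        cubeEnl (F.P K) (B14.Eq213MaximalDomains.side (F.P K).L M (j + 1)) a 0 ⊆ s.Ω j)
    (h3I : ∀ (s : SeqOfRecord F ν M S.flow.g K k) (W : MSField (F.P K) (SU N)), W ∈ regSuppOfRecord F N ν M S.flow.g K k cR s →
      W ∈ solvableDom (avOfRecord F N K) (regMSOfRecord F N ν K k s.Ω) (genSet s.Ω k) →
      ∀ j, 1 ≤ j → j ≤ k → ∀ X : (Sect2.domSys (F.P K) M j).Dom, Sect2.domSites (F.P K) M j X ⊆ s.Λ j →
      ∀ a ∈ cubeIndices (F.P K) (B14.Eq213MaximalDomains.side (F.P K).L M (j + 1)),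
        (cubeEnl (F.P K) (B14.Eq213MaximalDomains.side (F.P K).L M (j + 1)) a 0 ∩ Sect2.domSites (F.P K) M j X).Nonempty →
        ∀ q ∈ (Sect2.regionOfSet (F.P K) (cubeEnl (F.P K) (B14.Eq213MaximalDomains.side (F.P K).L M (j + 1)) a 0 ∩ Sect2.domSites (F.P K) M j X)).dpairs,
          ‖grad ((F.P K).eta j) q.2.1 (fun y => axialPotential (UbgMSOfRecord F N ν M S.flow.g K k s W)
            (boxLo (B14.Eq213MaximalDomains.side (F.P K).L M (j + 1)) a) (boxHi (B14.Eq213MaximalDomains.side (F.P K).L M (j + 1)) a) ((F.P K).eta j)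
            ⟨y, q.2.2⟩) q.1‖ < S.cB * S.lf.alpha0 (S.flow.g j))
    (h3MS : ∀ (s : SeqOfRecord F ν M S.flow.g K k) (W : MSField (F.P K) (SU N)), W ∈ regSuppOfRecord F N ν M S.flow.g K k cR s →
      W ∈ solvableDom (avOfRecord F N K) (regMSOfRecord F N ν K k s.Ω) (genSet s.Ω k) →
      ∀ j, 1 ≤ j → j ≤ k → ∀ X : (Sect2.domSys (F.P K) M j).Dom, ∀ n, 1 ≤ n → n ≤ j →
      ∀ a ∈ cubeIndices (F.P K) (B14.Eq213MaximalDomains.side (F.P K).L M n),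
        (cubeEnl (F.P K) (B14.Eq213MaximalDomains.side (F.P K).L M n) a 0 ∩ Sect2.domSites (F.P K) M j X).Nonempty →
        cubeEnl (F.P K) (B14.Eq213MaximalDomains.side (F.P K).L M n) a 0 ⊆ s.Ω n →
        ∀ q ∈ (Sect2.regionOfSet (F.P K) (cubeEnl (F.P K) (B14.Eq213MaximalDomains.side (F.P K).L M n) a 0 ∩ Sect2.domSites (F.P K) M j X)).dpairs,
          (((F.P K).L : ℝ) ^ n * (F.P K).eta j) ^ 2 * ‖grad ((F.P K).eta j) q.2.1 (fun y => axialPotential (UbgMSOfRecord F N ν M S.flow.g K k s W)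
            (boxLo (B14.Eq213MaximalDomains.side (F.P K).L M n) a) (boxHi (B14.Eq213MaximalDomains.side (F.P K).L M n) a) ((F.P K).eta j) ⟨y, q.2.2⟩) q.1‖ <
            rad238 S.B S.C S.Mr (S.lf.alpha0 (S.flow.g n))) :
    BgProvisoΛ F N K S (Sect2.Residual.unit (F.P K) (MatA N)) M k (regSuppOfRecord F N ν M S.flow.g K k cR) (UbgMSOfRecord F N ν M S.flow.g K k) := by
  have hBα' : ∀ n, 1 ≤ n → n ≤ k → B₃ * (cR * epsOfRecord ν S.flow.g n) ≤ S.lf.alpha0 (S.flow.g n) := by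
    intro n hn1 hnk
    refine (hBα n hn1 hnk).trans ?_
    have h0 := (hα n hn1 hnk).1.le
    nlinarith [hpos.βc_nonneg, h0]
  exact bgProvisoΛ_UbgMSOfRecord_of_thm1Scaled h15 S hι hS hpos ν M K k cR hnum ha₀ hα hBα
    (hloc_of_thm1Scaled_axial h15 S hι h𝓜 ν M K k cR hB₃ hnum ha₀ hBα' (fun n hn1 hnk => (hα n hn1 hnk).1)
      (fun j hj1 hjk => hsN (j + 1) (by omega) (by omega)) hcB hsmallI hcubeΩ h3I)
    (h238_of_thm1Scaled_axial h15 S hι h𝓜 ν M K k cR hB₃ hnum ha₀ hBα' (fun n hn1 hnk => (hα n hn1 hnk).1)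
      (fun n hn1 hnk => hsN n hn1 (by omega)) hBCM hsmallMS h3MS)

end Combined

end Literature.MathematicalPhysics.QuantumFieldTheory.Balaban1983to89.Node00

end
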